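import Summits.Ventures.PercRepro.C026PFunTwoLive

/-!
# A live probe with two live vertices: the summand, and the all-corner state on the tight curve
(p6, gen 17; mine-3 §35 (b), the comparison `(E_u) ⟸ (E_0)`)

With probe cells `(z, κ)` and two live vertices `a, b` at `(x₁, K₁)`, `(x₂, K₂)` (every other
vertex bare) the cells are `threeCells c a b z x₁ x₂`; the summand of a configuration is
`threeLiveVal z κ x₁ K₁ x₂ K₂ (c~a) (c~b) (a~b) (c~_ωᶜ a) (c~_ωᶜ b) (a~_ωᶜ b)`
(`pFun_threeCells_eq_sum`; the probe's factor `z` enters `X_c`, `κ` enters `K_c`, and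
`n̄(ωᶜ) = (2 − X_c(ωᶜ))·N_c(ωᶜ)` now depends on the whole blue pattern).

At the all-corner state of the live vertices (`x = K = 0` at `a, b`) and a probe ON THE TIGHT
CURVE `z = 1 − u`, `κ(1 + u) = 1 − 2u` (`u ∈ [0, ½]`), every symmetrised pair value satisfies
`(1 + u)·v_u ≥ (1 − u − 8u²)·v_0` with `v_0` its value at the bare probe
(`threeLiveVal_curve_add_ge`: the coefficients `8u² − 2u + 2`, `4u² − 4u + 4`, `4u² − u + 1`,
`1 + u` of mine-3's `(E_u)` against `2, 4, 1, 1` at `u = 0`, and `−(1 − u − 8u²)` on `(A, D)`),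
and is nonnegative outright once `1 − u − 8u² ≤ 0` (`threeLiveVal_curve_add_nonneg`).  Hence
**`pFun_threeCells_corner_nonneg_of_E00`**: `(E00)` ⟹ `(P) ≥ 0` at the all-corner state of the
two live vertices for EVERY probe on the tight curve — the `(L, L)`-corner piece of THEOREM L2
with a live probe (the off-piece pair values with a curve probe remain open).
-/

namespace PercRepro

namespace MultiGraph

open Finset

variable {V E : Type*} [Fintype V] [DecidableEq V]

/-- Cells with a live probe `c` at `z` and two live vertices `a, b` at `x₁, x₂`; `1` elsewhere. -/
noncomputable def threeCells (c a b : V) (z x₁ x₂ : ℝ) : V → ℝ :=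
  fun v => (if v = c then z else 1) * ((if v = a then x₁ else 1) * (if v = b then x₂ else 1))

omit [Fintype V] in
/-- With the probe bare the three-live cells are the two-live cells. -/
theorem threeCells_one (c a b : V) (x₁ x₂ : ℝ) : threeCells c a b 1 x₁ x₂ = twoCells a b x₁ x₂ := by
  funext v
  simp only [threeCells, twoCells]
  split_ifs <;> ring

omit [Fintype V] in
/-- The product of the three-live cells over a vertex set. -/
theorem prod_threeCells (c a b : V) (z x₁ x₂ : ℝ) (R : Finset V) :
    ∏ v ∈ R, threeCells c a b z x₁ x₂ v =
      (if c ∈ R then z else 1) * ((if a ∈ R then x₁ else 1) * (if b ∈ R then x₂ else 1)) := by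
  unfold threeCells
  rw [Finset.prod_mul_distrib, Finset.prod_mul_distrib, Finset.prod_ite_eq', Finset.prod_ite_eq',
    Finset.prod_ite_eq']

variable {G : MultiGraph V E}

open Classical in
/-- `X_c` with a live probe. -/
theorem xCluster_threeCells (c a b : V) (z x₁ x₂ : ℝ) (ω : Config E) :
    G.xCluster (threeCells c a b z x₁ x₂) c ω =
      z * ((if G.Conn ω c a then x₁ else 1) * (if G.Conn ω c b then x₂ else 1)) := by
  unfold xCluster
  rw [prod_threeCells, if_pos (self_mem_clusterF ω c)]
  simp only [mem_clusterF]

open Classical in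
/-- `K_c` with a live probe. -/
theorem kCluster_threeCells (c a b : V) (κ K₁ K₂ : ℝ) (ω : Config E) :
    G.kCluster (threeCells c a b κ K₁ K₂) c ω =
      κ * ((if G.Conn ω c a then K₁ else 1) * (if G.Conn ω c b then K₂ else 1)) := by
  unfold kCluster
  rw [prod_threeCells, if_pos (self_mem_clusterF ω c)]
  simp only [mem_clusterF]

/-- `N_c` does not see the probe's cell: the clusters off `c` carry no factor `z`. -/
theorem nbarOff_threeCells (c a b : V) (z x₁ x₂ : ℝ) (ω : Config E) :
    G.nbarOff (threeCells c a b z x₁ x₂) c ω = G.nbarOff (twoCells a b x₁ x₂) c ω := by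
  unfold nbarOff
  refine Finset.prod_congr rfl fun R hR => ?_
  rw [Finset.mem_erase] at hR
  rw [prod_threeCells, prod_twoCells, if_neg]
  · ring
  · intro hc
    exact hR.1 (clusterF_eq_of_mem hR.2 hc).symm

open Classical in
/-- `n̄ = (2 − X_c)·N_c` with a live probe. -/
theorem nbar_threeCells (c a b : V) (z x₁ x₂ : ℝ) (ω : Config E) :
    G.nbar (threeCells c a b z x₁ x₂) ω =
      (2 - z * ((if G.Conn ω c a then x₁ else 1) * (if G.Conn ω c b then x₂ else 1))) *
        G.nbarOff (twoCells a b x₁ x₂) c ω := by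
  rw [nbar_eq_mul_nbarOff _ _ c, xCluster_threeCells, nbarOff_threeCells]

/-! ### The summand as a function of the two patterns -/

/-- `N_c` as a function of the red pattern (cells in `[0, 1]`). -/
noncomputable def nOff (x₁ x₂ : ℝ) (ra rb rab : Prop) [Decidable ra] [Decidable rb]
    [Decidable rab] : ℝ :=
  if ra then (if rb then 1 else 2 - x₂)
  else (if rb then 2 - x₁ else (if rab then 2 - x₁ * x₂ else (2 - x₁) * (2 - x₂)))

/-- The `(P)`-summand with a live probe `(z, κ)` and live vertices `(x₁, K₁)`, `(x₂, K₂)`, as a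
function of the red pattern `(c~a, c~b, a~b)` and the blue pattern `(c~_ωᶜ a, c~_ωᶜ b, a~_ωᶜ b)`. -/
noncomputable def threeLiveVal (z κ x₁ K₁ x₂ K₂ : ℝ) (ra rb rab ba bb bab : Prop) [Decidable ra]
    [Decidable rb] [Decidable rab] [Decidable ba] [Decidable bb] [Decidable bab] : ℝ :=
  nOff x₁ x₂ ra rb rab * (1 - 2 * (z * ((if ra then x₁ else 1) * (if rb then x₂ else 1)))) +
    (κ * ((if ra then K₁ else 1) * (if rb then K₂ else 1))) *
      ((2 - z * ((if ba then x₁ else 1) * (if bb then x₂ else 1))) * nOff x₁ x₂ ba bb bab)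

variable [Fintype E] [DecidableEq E]

open Classical in
/-- **`(P)` with a live probe and two live vertices as a configuration sum over the patterns.** -/
theorem pFun_threeCells_eq_sum (c a b : V) (z κ : ℝ) {x₁ x₂ : ℝ} (hx₁ : 0 ≤ x₁ ∧ x₁ ≤ 1)
    (hx₂ : 0 ≤ x₂ ∧ x₂ ≤ 1) (K₁ K₂ : ℝ) :
    G.pFun c (threeCells c a b z x₁ x₂) (threeCells c a b κ K₁ K₂) univ =
      ∑ ω : Config E, threeLiveVal z κ x₁ K₁ x₂ K₂ (G.Conn ω c a) (G.Conn ω c b) (G.Conn ω a b)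
        (G.Conn ωᶜ c a) (G.Conn ωᶜ c b) (G.Conn ωᶜ a b) := by
  unfold pFun
  rw [configsIn_univ]
  simp only [complIn_univ, ← config_compl_eq_not]
  refine Finset.sum_congr rfl fun ω _ => ?_
  rw [nbarOff_threeCells, nbarOff_twoCells a b c hx₁ hx₂, xCluster_threeCells,
    kCluster_threeCells, nbar_threeCells, nbarOff_twoCells a b c hx₁ hx₂]
  rfl

/-! ### The all-corner state of the live vertices with a probe on the tight curve -/

omit [Fintype V] [DecidableEq V] [Fintype E] [DecidableEq E] in
/-- **The pointwise comparison `(E_u) ⟸ (E_0)`** (mine-3 §35 (b)): at the all-corner state of the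
live vertices, for a probe on the tight curve `z = 1 − u`, `κ(1 + u) = 1 − 2u`, `0 ≤ u ≤ ½`,
every symmetrised pair value satisfies `(1 + u)·v_u ≥ (1 − u − 8u²)·v_0`. -/
theorem threeLiveVal_curve_add_ge {u κ : ℝ} (hu : 0 ≤ u ∧ u ≤ 1 / 2) (hκ : κ * (1 + u) = 1 - 2 * u)
    (ra rb rab ba bb bab : Prop) [Decidable ra] [Decidable rb] [Decidable rab] [Decidable ba]
    [Decidable bb] [Decidable bab] (r1 : ra → rb → rab) (r2 : ra → rab → rb) (r3 : rb → rab → ra)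
    (b1 : ba → bb → bab) (b2 : ba → bab → bb) (b3 : bb → bab → ba) :
    (1 - u - 8 * u ^ 2) *
        (threeLiveVal 1 1 0 0 0 0 ra rb rab ba bb bab + threeLiveVal 1 1 0 0 0 0 ba bb bab ra rb rab) ≤
      (1 + u) * (threeLiveVal (1 - u) κ 0 0 0 0 ra rb rab ba bb bab +
        threeLiveVal (1 - u) κ 0 0 0 0 ba bb bab ra rb rab) := by
  unfold threeLiveVal nOff
  obtain ⟨hu0, hu1⟩ := hu
  by_cases hra : ra <;> by_cases hrb : rb <;> by_cases hrab : rab <;> by_cases hba : ba <;>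
    by_cases hbb : bb <;> by_cases hbab : bab <;>
    first
    | exact absurd (r1 hra hrb) hrab
    | exact absurd (r2 hra hrab) hrb
    | exact absurd (r3 hrb hrab) hra
    | exact absurd (b1 hba hbb) hbab
    | exact absurd (b2 hba hbab) hbb
    | exact absurd (b3 hbb hbab) hba
    | (simp only [hra, hrb, hrab, hba, hbb, hbab, if_true, if_false]
       nlinarith [hκ, sq_nonneg u, mul_nonneg hu0 hu0, mul_nonneg hu0 (mul_nonneg hu0 hu0)])

omit [Fintype V] [DecidableEq V] [Fintype E] [DecidableEq E] in
/-- Once `1 − u − 8u² ≤ 0` every symmetrised pair value at the all-corner state with a curve probe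
is nonnegative (the `(A, D)` value is `−(1 − u − 8u²)/(1 + u)`; the others are positive). -/
theorem threeLiveVal_curve_add_nonneg {u κ : ℝ} (hu : 0 ≤ u ∧ u ≤ 1 / 2)
    (hκ : κ * (1 + u) = 1 - 2 * u) (hstar : 1 - u - 8 * u ^ 2 ≤ 0)
    (ra rb rab ba bb bab : Prop) [Decidable ra] [Decidable rb] [Decidable rab] [Decidable ba]
    [Decidable bb] [Decidable bab] (r1 : ra → rb → rab) (r2 : ra → rab → rb) (r3 : rb → rab → ra)
    (b1 : ba → bb → bab) (b2 : ba → bab → bb) (b3 : bb → bab → ba) :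
    0 ≤ threeLiveVal (1 - u) κ 0 0 0 0 ra rb rab ba bb bab +
      threeLiveVal (1 - u) κ 0 0 0 0 ba bb bab ra rb rab := by
  unfold threeLiveVal nOff
  obtain ⟨hu0, hu1⟩ := hu
  have hκ0 : 0 ≤ κ := by nlinarith
  by_cases hra : ra <;> by_cases hrb : rb <;> by_cases hrab : rab <;> by_cases hba : ba <;>
    by_cases hbb : bb <;> by_cases hbab : bab <;>
    first
    | exact absurd (r1 hra hrb) hrab
    | exact absurd (r2 hra hrab) hrb
    | exact absurd (r3 hrb hrab) hra
    | exact absurd (b1 hba hbb) hbab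
    | exact absurd (b2 hba hbab) hbb
    | exact absurd (b3 hbb hbab) hba
    | (simp only [hra, hrb, hrab, hba, hbb, hbab, if_true, if_false]
       nlinarith [hκ, hκ0, sq_nonneg u, mul_nonneg hu0 hu0, mul_nonneg hκ0 hu0])

omit [Fintype V] in
/-- The all-corner cells of the live vertices with a bare probe are `liveCells`. -/
theorem threeCells_one_zero_zero (c a b : V) : threeCells c a b 1 0 0 = liveCells a b := by
  rw [threeCells_one, twoCells_zero_zero]

open Classical in
/-- **`(E00)` ⟹ the all-corner value with a probe ANYWHERE on the tight curve is nonnegative**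
(the `(L, L)`-corner piece of THEOREM L2 with a live probe): for `z = 1 − u`,
`κ(1 + u) = 1 − 2u`, `u ∈ [0, ½]`. -/
theorem pFun_threeCells_corner_nonneg_of_E00 (c a b : V) {u κ : ℝ} (hu : 0 ≤ u ∧ u ≤ 1 / 2)
    (hκ : κ * (1 + u) = 1 - 2 * u)
    (hE00 : 0 ≤ G.pFun c (liveCells a b) (liveCells a b) univ) :
    0 ≤ G.pFun c (threeCells c a b (1 - u) 0 0) (threeCells c a b κ 0 0) univ := by
  have h01 : (0 : ℝ) ≤ 0 ∧ (0 : ℝ) ≤ 1 := by norm_num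
  have hsym : ∀ f : Config E → ℝ, ∑ ω, f ω = (∑ ω, (f ω + f ωᶜ)) / 2 := by
    intro f
    rw [Finset.sum_add_distrib, sum_compl_config_eq f]
    ring
  rw [pFun_threeCells_eq_sum c a b (1 - u) κ h01 h01 0 0, hsym]
  refine div_nonneg ?_ (by norm_num)
  rcases le_or_gt 0 (1 - u - 8 * u ^ 2) with hstar | hstar
  · -- `(1 + u)·(P)_u ≥ (1 − u − 8u²)·(P)_0 ≥ 0`
    have hE : 0 ≤ ∑ ω : Config E, (threeLiveVal 1 1 0 0 0 0 (G.Conn ω c a) (G.Conn ω c b)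
        (G.Conn ω a b) (G.Conn ωᶜ c a) (G.Conn ωᶜ c b) (G.Conn ωᶜ a b) +
        threeLiveVal 1 1 0 0 0 0 (G.Conn ωᶜ c a) (G.Conn ωᶜ c b) (G.Conn ωᶜ a b)
          (G.Conn ωᶜᶜ c a) (G.Conn ωᶜᶜ c b) (G.Conn ωᶜᶜ a b)) := by
      have h := hE00
      rw [← threeCells_one_zero_zero c a b, pFun_threeCells_eq_sum c a b 1 1 h01 h01 0 0, hsym] at h
      have := (div_nonneg_iff.1 h)
      rcases this with ⟨h', _⟩ | ⟨_, h'⟩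
      · exact h'
      · linarith
    have hcmp : (1 - u - 8 * u ^ 2) * ∑ ω : Config E,
        (threeLiveVal 1 1 0 0 0 0 (G.Conn ω c a) (G.Conn ω c b) (G.Conn ω a b) (G.Conn ωᶜ c a)
          (G.Conn ωᶜ c b) (G.Conn ωᶜ a b) +
        threeLiveVal 1 1 0 0 0 0 (G.Conn ωᶜ c a) (G.Conn ωᶜ c b) (G.Conn ωᶜ a b)
          (G.Conn ωᶜᶜ c a) (G.Conn ωᶜᶜ c b) (G.Conn ωᶜᶜ a b)) ≤
        (1 + u) * ∑ ω : Config E,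
        (threeLiveVal (1 - u) κ 0 0 0 0 (G.Conn ω c a) (G.Conn ω c b) (G.Conn ω a b)
          (G.Conn ωᶜ c a) (G.Conn ωᶜ c b) (G.Conn ωᶜ a b) +
        threeLiveVal (1 - u) κ 0 0 0 0 (G.Conn ωᶜ c a) (G.Conn ωᶜ c b) (G.Conn ωᶜ a b)
          (G.Conn ωᶜᶜ c a) (G.Conn ωᶜᶜ c b) (G.Conn ωᶜᶜ a b)) := by
      rw [Finset.mul_sum, Finset.mul_sum]
      refine Finset.sum_le_sum fun ω _ => ?_
      simp only [compl_compl]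
      exact threeLiveVal_curve_add_ge hu hκ _ _ _ _ _ _
        (fun h1 h2 => h1.symm.trans h2) (fun h1 h2 => h1.trans h2) (fun h1 h2 => h1.trans h2.symm)
        (fun h1 h2 => h1.symm.trans h2) (fun h1 h2 => h1.trans h2) (fun h1 h2 => h1.trans h2.symm)
    have hpos : 0 < 1 + u := by linarith [hu.1]
    have := mul_nonneg hstar hE
    exact (mul_nonneg_iff_of_pos_left hpos).1 (this.trans hcmp)
  · -- every pair value is nonnegative
    refine Finset.sum_nonneg fun ω _ => ?_
    simp only [compl_compl]
    exact threeLiveVal_curve_add_nonneg hu hκ hstar.le _ _ _ _ _ _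
      (fun h1 h2 => h1.symm.trans h2) (fun h1 h2 => h1.trans h2) (fun h1 h2 => h1.trans h2.symm)
      (fun h1 h2 => h1.symm.trans h2) (fun h1 h2 => h1.trans h2) (fun h1 h2 => h1.trans h2.symm)

end MultiGraph

end PercRepro
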